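import Summits.BirchSwinnertonDyer.BirchSwinnertonDyer.Theorems.SylvesterTwoHeegnerIndexUpperOffV0NoTwoTorsionNormal
import Summits.BirchSwinnertonDyer.Rank1Residual.X11b.RingClassFieldNoTorsion
import Summits.BirchSwinnertonDyer.Rank1Residual.X11b.RingClassFieldConj
import Literature.NumberTheory.EllipticCurves.RingClassFieldGenusProofs
import HarnessLib

/-!
# K7t crux `UpperOffV0HSYPlus` (item 19804), line `offv0-kolyvagin2`: the `hA` input of stub (d)
# AT `p = 2` — `K[n]/ℚ` normal, `ω ∉ K[n]`, `E_p(K[n])[2^M] = 0`, admissibility of `E_p(K[n]) ⊆ E_p(K̄)`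

Helper file of route `SylvesterTwoHeegnerIndex` (cell bsd-cm, rung K7t); sequel of k7t-c2 g5's
`…UpperOffV0NoTwoTorsionNormal` (`E_p(L)[2] = 0` for every normal `L/ℚ` with `ω ∉ L`).  Kolyvagin's
derivative classes (stub (d) `stub_kolyvaginClasses_two` of the registered skeleton, in the concrete
currency of the tree's `KolyvaginHeegnerData`) need ADMISSIBLE subgroups `A_m = E(K_m) ⊆ E(K̄)`:
`Γ_K`-stable and WITHOUT `2^M`-torsion (`KolyvaginCocycle.IsAdmissible`).  At an odd prime `p` with
`ρ̄_{E,p}` onto this is Gross 1991, Lemma 4.3 / McCallum 1991, §4 (5), in the tree as x11b3's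
`X11b.RingClassNoTorsion.isAdmissible_pointsSubgroup` (hypotheses `p ≠ 2`, `Surj W p`).  AT `p = 2` for
the Sylvester curves `E_p : y² = x³ − 432p²` the replacement is field-theoretic and is PROVED here:

* `sq_add_self_add_one_ne_zero_ringClassField` — **`ω ∉ K[n]`** for `3 ∤ n`, `3 ∤ d_K`: `2ω + 1` is a
  square root of `−3`, excluded from `K[n]` by the tree's PROVED
  `sqrt_intCast_not_mem_ringClassField` (Cox §9.A: primes of `K` ramified in `K[n]` divide `n`;
  `K(√−3)/K` is ramified above `3`);
* `two_torsion_eq_zero_ringClassField_of_model`, `torsionBy_two_ringClassField_eq_bot`,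
  `torsionBy_two_pow_ringClassField_eq_bot`, `eq_zero_of_zsmul_two_pow_eq_zero_ringClassField` —
  **`E(K[n])[2] = 0` and `E(K[n])[2^M] = 0` for every `ℚ`-model of `E_p`** (`p` an odd prime,
  `3 ∤ n`, `3 ∤ d_K`) — Gross's Lemma 4.3 AT `p = 2` on 𝒞_HSY — from g5's
  `two_torsion_eq_zero_of_model_of_normal`, `K[n]/ℚ` being Galois by x11b3's
  `RingClassConj.isGalois_rat_ringClassField` (Cox Lemma 9.3 (i); imported, not restated);
* `isAdmissible_pointsSubgroup_two`, `isAdmissible_pointsSubgroup_two_of_dvd` — **the `hA` binder at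
  `2`**: for every concrete Kolyvagin–Heegner datum `d` at level `n` (resp. a family at the divisors
  of `n`), `E(K[n]) ⊆ E(K̄)` is `KolyvaginCocycle.IsAdmissible Γ_K · 2^M` — `Γ_K`-stability being
  x11b3's `RingClassNoTorsion.smul_toGeomPoints_eq` (`p`-free), imported, not restated.

At the Kolyvagin levels of the line the side conditions hold: `n` is a product of Kolyvagin primes
`ℓ ∤ N` with `3 ∣ N` (so `3 ∤ n`), and `3` splits in the Heegner field (so `3 ∤ d_K`).
THEOREMS ONLY (no definition, no named fact, no `sorry`); closes nothing; B14 = O12 open as a class;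
BSD not claimed.  References: [GrossLMS1991] Lemma 4.3, (4.2); [McCallumLMS1991] §4 (5);
[Cox2013] §9.A p. 180, Lemma 9.3.
-/

set_option autoImplicit false
set_option linter.dupNamespace false

noncomputable section

open scoped Classical

open Literature.NumberTheory.EllipticCurves Literature.NumberTheory.EllipticCurves.HuShuYin2019
  Literature.NumberTheory.EllipticCurves.RingClassField Literature.NumberTheory.EllipticCurves.ModularForms
  WeierstrassCurve NumberField Field

namespace Summit.BirchSwinnertonDyer.BirchSwinnertonDyer.Theorems.SylvesterTwoUpper

-- `K : Type`: the tree's ring-class class field theory is universe `0`.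
variable {K : Type} [Field K] [NumberField K]

/-! ## §1 `ω ∉ K[n]` for `3 ∤ n`, `3 ∤ d_K` -/

/-- **`ω ∉ K[n]`**: for `K` imaginary quadratic, `n ≠ 0` with `3 ∤ n` and `3 ∤ d_K`, the ring class
field `K[n]` contains no root of `X² + X + 1` — for such a root `x`, `(2x + 1)² = −3`, and `√−3 ∉ K[n]`
because `K[n]/K` is unramified above `3 ∤ n` (Cox §9.A) while `3 ∤ d_K` is unramified in `K` and
`ord₃(−3) = 1` is odd (the tree's `sqrt_intCast_not_mem_ringClassField` with `d = −3`, `ℓ = 3`).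
[cite: Cox2013, §9.A p. 180 (ramified primes divide f𝒪_K)] -/
theorem sq_add_self_add_one_ne_zero_ringClassField (hK : IsImaginaryQuadratic K) (ι : K →+* ℂ)
    {n : ℕ} (hn : n ≠ 0) (h3n : ¬ 3 ∣ n) (h3D : ¬ (3 : ℤ) ∣ NumberField.discr K)
    (x : ringClassField K ι n) : x ^ 2 + x + 1 ≠ 0 := by
  intro hx
  have hr : ((2 * x + 1 : ringClassField K ι n) : ℂ) ^ 2 = ((-3 : ℤ) : ℂ) := by
    have h : (2 * x + 1 : ringClassField K ι n) ^ 2 = -3 := by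
      linear_combination (4 : ringClassField K ι n) * hx
    have h' := congrArg (fun y : ringClassField K ι n ↦ (y : ℂ)) h
    push_cast at h' ⊢
    exact h'
  exact sqrt_intCast_not_mem_ringClassField hK ι hn Nat.prime_three (d := -3)
    (by norm_num) (by norm_num) h3n h3D _ hr (2 * x + 1).2

/-! ## §2 `E_p(K[n])[2] = 0`, `E_p(K[n])[2^M] = 0` -/

/-- **Gross's Lemma 4.3 AT `p = 2` on 𝒞_HSY, point form**: for `W` any `ℚ`-model of `E_p`
(`p` an odd prime), `K` imaginary quadratic, `n ≠ 0`, `3 ∤ n`, `3 ∤ d_K`: a point `Q ∈ W(K[n])` with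
`2Q = 0` is `0` (`K[n]/ℚ` is Galois — Cox Lemma 9.3 (i), x11b3 — and `ω ∉ K[n]`, so `432p²` has no cube
root in `K[n]`). [cite: Cox2013, §9.A Lemma 9.3 (i)]
[cite: GrossLMS1991, Lemma 4.3 (p = 2 replacement)] [cite: McCallumLMS1991, §4 (5)] -/
theorem two_torsion_eq_zero_ringClassField_of_model {p : ℕ} (hp : p.Prime) (hp2 : p ≠ 2)
    (W : WeierstrassCurve ℚ) (hW : ∃ C : VariableChange ℚ, C • W = cubeSumCurve (p : ℚ))
    (hK : IsImaginaryQuadratic K) (ι : K →+* ℂ) {n : ℕ} (hn : n ≠ 0) (h3n : ¬ 3 ∣ n)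
    (h3D : ¬ (3 : ℤ) ∣ NumberField.discr K)
    (Q : (W.baseChange (ringClassField K ι n)).toAffine.Point) (hQ : 2 • Q = 0) : Q = 0 := by
  -- `K[n]/ℚ` is Galois (x11b3's `RingClassConj.isGalois_rat_ringClassField`, Cox Lemma 9.3 (i))
  haveI := Summit.BirchSwinnertonDyer.Rank1Residual.X11b.RingClassConj.isGalois_rat_ringClassField
    hK ι hn
  -- the tree lemma is stated for the classical `DecidableEq` on `K[n]`; the group law here uses the
  -- subtype instance inherited from `ℂ` — `convert` bridges the (subsingleton) instance arguments
  have h := two_torsion_eq_zero_of_model_of_normal hp hp2 W hW (ringClassField K ι n)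
    (sq_add_self_add_one_ne_zero_ringClassField hK ι hn h3n h3D) Q
  exact h (by convert hQ)

/-- **`E(K[n])[2] = 0`** (subgroup form) for every `ℚ`-model of `E_p`, `3 ∤ n`, `3 ∤ d_K`.
[cite: GrossLMS1991, Lemma 4.3 (p = 2 replacement)] -/
theorem torsionBy_two_ringClassField_eq_bot {p : ℕ} (hp : p.Prime) (hp2 : p ≠ 2)
    (W : WeierstrassCurve ℚ) (hW : ∃ C : VariableChange ℚ, C • W = cubeSumCurve (p : ℚ))
    (hK : IsImaginaryQuadratic K) (ι : K →+* ℂ) {n : ℕ} (hn : n ≠ 0) (h3n : ¬ 3 ∣ n)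
    (h3D : ¬ (3 : ℤ) ∣ NumberField.discr K) :
    AddSubgroup.torsionBy (W.baseChange (ringClassField K ι n)).toAffine.Point ((2 : ℕ) : ℤ) = ⊥ := by
  rw [eq_bot_iff]
  intro Q hQ
  rw [AddSubgroup.mem_bot]
  have h2 : 2 • Q = 0 := by
    have := AddSubgroup.torsionBy.nsmul_iff.mp hQ
    simpa using this
  exact two_torsion_eq_zero_ringClassField_of_model hp hp2 W hW hK ι hn h3n h3D Q h2

/-- **`E(K[n])[2^M] = 0`** for every `ℚ`-model of `E_p`, `3 ∤ n`, `3 ∤ d_K` (McCallum §4 (5) at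
`p = 2`: uniqueness of `2^M`-division points in `E(K_n)`). [cite: McCallumLMS1991, §4 (5)] -/
theorem torsionBy_two_pow_ringClassField_eq_bot {p : ℕ} (hp : p.Prime) (hp2 : p ≠ 2)
    (W : WeierstrassCurve ℚ) (hW : ∃ C : VariableChange ℚ, C • W = cubeSumCurve (p : ℚ))
    (hK : IsImaginaryQuadratic K) (ι : K →+* ℂ) {n : ℕ} (hn : n ≠ 0) (h3n : ¬ 3 ∣ n)
    (h3D : ¬ (3 : ℤ) ∣ NumberField.discr K) (M : ℕ) :
    AddSubgroup.torsionBy (W.baseChange (ringClassField K ι n)).toAffine.Point ((2 ^ M : ℕ) : ℤ) = ⊥ :=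
  torsionBy_pow_eq_bot (p := 2) (torsionBy_two_ringClassField_eq_bot hp hp2 W hW hK ι hn h3n h3D) M

/-- **No `2^M`-torsion in `E(K[n])`, element form**: `2^M • R = 0 ⇒ R = 0`.
[cite: McCallumLMS1991, §4 (5)] -/
theorem eq_zero_of_zsmul_two_pow_eq_zero_ringClassField {p : ℕ} (hp : p.Prime) (hp2 : p ≠ 2)
    (W : WeierstrassCurve ℚ) (hW : ∃ C : VariableChange ℚ, C • W = cubeSumCurve (p : ℚ))
    (hK : IsImaginaryQuadratic K) (ι : K →+* ℂ) {n : ℕ} (hn : n ≠ 0) (h3n : ¬ 3 ∣ n)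
    (h3D : ¬ (3 : ℤ) ∣ NumberField.discr K) (M : ℕ)
    (R : (W.baseChange (ringClassField K ι n)).toAffine.Point) (hR : ((2 ^ M : ℕ) : ℤ) • R = 0) :
    R = 0 := by
  have h : R ∈ AddSubgroup.torsionBy (W.baseChange (ringClassField K ι n)).toAffine.Point
      ((2 ^ M : ℕ) : ℤ) := (Submodule.mem_torsionBy_iff ((2 ^ M : ℕ) : ℤ) R).mpr hR
  rwa [torsionBy_two_pow_ringClassField_eq_bot hp hp2 W hW hK ι hn h3n h3D M, AddSubgroup.mem_bot] at h

/-! ## §3 The `hA` binder at `2`: admissibility of `E(K[n]) ⊆ E(K̄)` for concrete Kolyvagin–Heegner data -/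

section KolyvaginHeegnerData

variable {N : ℕ} [NeZero N] {W : WeierstrassCurve ℚ} {Dt : ModularParametrizationData W N} {β : ℤ}
  {ι : K →+* ℂ} {n : ℕ}

/-- **The `hA` binder AT `p = 2` for 𝒞_HSY** — for `W` a `ℚ`-model of `E_p` (`p` an odd prime),
`K` imaginary quadratic, a concrete Kolyvagin–Heegner datum `d` at level `n ≠ 0` with `3 ∤ n`,
`3 ∤ d_K`, and any `M`: the subgroup `d.pointsSubgroup = E(K[n]) ⊆ E(K̄)` is `Γ_K`-stable (x11b3's
`RingClassNoTorsion.smul_toGeomPoints_eq`, Gross (4.2)) and `2^M`-torsion-free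
(`torsionBy_two_pow_ringClassField_eq_bot`), i.e. `KolyvaginCocycle.IsAdmissible Γ_K d.pointsSubgroup 2^M`
— the standing input `hA` of `d.kolyvaginClass` / `kolyvaginClass_of_admissible` AT `2`, with NO
image hypothesis. [cite: McCallumLMS1991, §4 (5)] [cite: GrossLMS1991, §4, Lemma 4.3 and (4.2)] -/
theorem isAdmissible_pointsSubgroup_two [W.IsElliptic] (d : KolyvaginHeegnerData Dt β ι n)
    {p : ℕ} (hp : p.Prime) (hp2 : p ≠ 2) (hW : ∃ C : VariableChange ℚ, C • W = cubeSumCurve (p : ℚ))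
    (hK : IsImaginaryQuadratic K) (hn : n ≠ 0) (h3n : ¬ 3 ∣ n)
    (h3D : ¬ (3 : ℤ) ∣ NumberField.discr K) (M : ℕ) :
    KolyvaginCocycle.IsAdmissible (absoluteGaloisGroup K) d.pointsSubgroup ((2 ^ M : ℕ) : ℤ) where
  smul_mem g := by
    rintro _ ⟨P, rfl⟩
    exact ⟨_, (Summit.BirchSwinnertonDyer.Rank1Residual.X11b.RingClassNoTorsion.smul_toGeomPoints_eq
      d hK hn g P).symm⟩
  eq_zero_of_zsmul := by
    rintro _ ⟨P, rfl⟩ hP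
    rw [← map_zsmul] at hP
    have hP0 : ((2 ^ M : ℕ) : ℤ) • P = 0 :=
      (Affine.Point.map_injective (W' := W) d.emb.toRatAlgHom) (by rw [map_zero]; exact hP)
    rw [eq_zero_of_zsmul_two_pow_eq_zero_ringClassField hp hp2 W hW hK ι hn h3n h3D M P hP0, map_zero]

/-- **Family form of the `hA` binder at `2`** — for a family of concrete Kolyvagin–Heegner data
`d m : KolyvaginHeegnerData Dt β ι m` at the divisors `m ∣ n` of one top level `n ≠ 0` with `3 ∤ n`
(the currency of the concrete `h44` chain: `hA : ∀ m (hm : m ∣ n), IsAdmissible Γ_K (d m hm).pointsSubgroup 2^M`),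
every `E(K[m]) ⊆ E(K̄)` is admissible. [cite: McCallumLMS1991, §4 (5)] [cite: GrossLMS1991, §4, Lemma 4.3 and (4.2)] -/
theorem isAdmissible_pointsSubgroup_two_of_dvd [W.IsElliptic] (hn : n ≠ 0) (h3n : ¬ 3 ∣ n)
    (d : ∀ m : ℕ, m ∣ n → KolyvaginHeegnerData Dt β ι m) {p : ℕ} (hp : p.Prime) (hp2 : p ≠ 2)
    (hW : ∃ C : VariableChange ℚ, C • W = cubeSumCurve (p : ℚ)) (hK : IsImaginaryQuadratic K)
    (h3D : ¬ (3 : ℤ) ∣ NumberField.discr K) (M : ℕ) (m : ℕ) (hm : m ∣ n) :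
    KolyvaginCocycle.IsAdmissible (absoluteGaloisGroup K) (d m hm).pointsSubgroup ((2 ^ M : ℕ) : ℤ) :=
  isAdmissible_pointsSubgroup_two (d m hm) hp hp2 hW hK (ne_zero_of_dvd_ne_zero hn hm)
    (fun h3m ↦ h3n (h3m.trans hm)) h3D M

end KolyvaginHeegnerData

end Summit.BirchSwinnertonDyer.BirchSwinnertonDyer.Theorems.SylvesterTwoUpper

end
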